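import Summits.KontsevichZagierPeriods.KontsevichZagierPeriods.Theorems.LinRedNormalFormArrangementNormalFormStubRebaseSimpleZeroManyChainJanusCells
import Summits.KontsevichZagierPeriods.KontsevichZagierPeriods.Theorems.LinRedNormalFormArrangementNormalFormStubRebaseSimpleZeroNestedGrid

/-!
# Stub `stub_rebaseSimpleZeroMany`, part `rebaseSimpleZeroMany_common` (crux `ArrangementNormalForm`,
line `janus-bands`) — brick `ChainGrid`

SEPARABLE and THICK clean chains `A < t₀ < ⋯ < tₙ < B` of `n + 1` fibres over a one-dimensional
base (constant letters, `RebaseChain.IsChain`) are good for `GG 0 2 (n + 1)`: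
* `IsChain.good_sep` — a constant `κ` with `A ≤ κ ≤ B` on the base cell: rule (1a) by the
  position of `κ` among the fibres gives the cells `[A < t₀ < ⋯ < t_{r−1} < κ] × [κ < tᵣ < ⋯ < B]`
  (`r = 0, …, n + 1`; these are the Janus cells `RebaseChain.jDom` of brick `ChainSubJanus` with
  `(T₀, A, B) ↦ (A, κ, B)`, all restrictions of the chain itself), each with one pivot per block
  (`RebaseChain.good_bdom`);
* `IsChain.good_thick` — `B − A ≥ m₀ > 0` on the base cell: an explicit rational grid of mesh `h`
  with `|A'| h ≤ m₀` cuts the base (rule 1a) into pieces on which the chain is separable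
  (`IsChain.good_short`, `IsChain.good_grid`; as in brick `NestedGrid` of the pair case).
Registered: `rebaseSimpleZeroMany_chainThick`.

References: M. Kontsevich, D. Zagier, *Periods* (2001), §1.2, rules (1a), (2).
-/

noncomputable section

open Set MeasureTheory MvPolynomial
open Literature.NumberTheory.Transcendental Literature.ModelTheory.ExponentialFields

namespace Summit.KontsevichZagierPeriods.ArrangementNormalForm.JanusBands

namespace RebaseChain

open SeparatePos RebasePos RebaseZero RebaseNest

variable {n m' : ℕ} {s : KZ.IntegralRep (0 + 1 + (n + 1))} {M : Fin m' → Cf} {A Bd : Cf} {T : BData}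
  {p : MvPolynomial (Fin 0) ℚ} {a : Fin (n + 1) → Option Cf}

/-! ### Separable chains -/

/-- The clean chain is the unpinched Janus cell `jDom ∅ (n + 1) 0` of the triple `(A, κ, B)`. -/
theorem chain_eq_jDom_top (M : Fin m' → Cf) (A K Bd : Cf) :
    gDom 0 (n + 1) m' M (clo A) (chi Bd) = jDom M ∅ A K Bd (n + 1) 0 := by
  have hU : jU (n := n) A K (n + 1) = fun _ => A := funext fun l => jU_of_lt l.isLt
  have hV : jV (n := n) K Bd 0 = fun _ => Bd := funext fun l => jV_of_le (Nat.zero_le _)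
  rw [jDom, hU, hV, clo_eq_blo, chi_eq_bhi]

/-- **The cells of a separable chain are good**: `[A < t₀ < ⋯ < t_{r−1} < κ] × [κ < tᵣ < ⋯ < B]`
has the pivot `A` on the lower block and `B` on the upper one (`κ` constant). -/
theorem good_sepCell {κ : ℚ} {K : Cf} (hK : (RebaseZero.mk 0 κ : Cf) = K) (h12 : T.n₁ = 0 ∨ T.n₂ = 0)
    (ha0 : ∀ l d, a l = some d → d.1 (Fin.last 0) = 0) {r : ℕ} (c : Finset ℕ)
    (hc : ∀ j : Fin n, (j : ℕ) ∉ c → (j : ℕ) + 1 ≠ r) {s' : KZ.IntegralRep (0 + 1 + (n + 1))}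
    (hbd : Bornology.IsBounded s'.domain) (hdom : s'.domain = jDom M c A K Bd r r)
    (hint : EqOn s'.integrand (glitB T p a) s'.domain) : Good (n + 1) (KZ.of s') := by
  classical
  have hK0 : K.1 (Fin.last 0) = 0 := by rw [← hK]; rfl
  refine good_bdom c (jU A K r) (jV K Bd r) h12 hbd hdom hint ha0 (fun l => if (l : ℕ) < r then A else Bd)
    (fun j hj => ?_) (fun l => ?_) fun l => ?_
  · have hne := hc j hj
    by_cases h1 : ((j.succ : Fin (n + 1)) : ℕ) < r
    · rw [if_pos h1, if_pos (show ((j.castSucc : Fin (n + 1)) : ℕ) < r by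
        rw [Fin.val_castSucc]; rw [Fin.val_succ] at h1; omega)]
    · have h2 : ¬ ((j.castSucc : Fin (n + 1)) : ℕ) < r := by
        rw [Fin.val_castSucc]; rw [Fin.val_succ] at h1; omega
      rw [if_neg h1, if_neg h2]
  · by_cases h : (l : ℕ) < r
    · rw [jU_of_lt h, if_pos h]; exact Or.inl rfl
    · rw [jU_of_le (not_lt.1 h)]; exact Or.inr hK0
  · by_cases h : (l : ℕ) < r
    · rw [jV_of_lt h]; exact Or.inr hK0
    · rw [jV_of_le (not_lt.1 h), if_neg h]; exact Or.inl rfl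

/-- **Separable chains are good** (rules 1a + 2). If a constant `κ` satisfies `A ≤ κ ≤ B` on the
base cell, the clean chain is good: cut by the position of `κ` among the fibres (the ties
`tₗ = κ` are null) into the cells `[A < ⋯ < t_{r−1} < κ] × [κ < tᵣ < ⋯ < B]`, `r = 0, …, n + 1`,
each of which has one pivot per block. [Kontsevich–Zagier 2001, §1.2, rules (1), (2)] -/
theorem IsChain.good_sep (h : IsChain s M A Bd T p a) (κ : ℚ)
    (hκ : ∀ y ∈ cell M, ev A y ≤ κ ∧ (κ : ℝ) ≤ ev Bd y) : Good (n + 1) (KZ.of s) := by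
  classical
  set K : Cf := RebaseZero.mk 0 κ with hKdef
  have hKv : ∀ y, ev K y = κ := fun y => by rw [hKdef, ev_mk, Rat.cast_zero, zero_mul, zero_add]
  have hAK : ∀ y ∈ cell M, ev A y ≤ ev K y := fun y hy => by rw [hKv]; exact (hκ y hy).1
  have hKB : ∀ y ∈ cell M, ev K y ≤ ev Bd y := fun y hy => by rw [hKv]; exact (hκ y hy).2
  have hr : 0 < n + 1 := Nat.succ_pos n
  have hc : ∀ j ∈ (∅ : Finset ℕ), j < 0 := fun j hj => absurd hj (Finset.notMem_empty j)
  have hcr : ∀ j : Fin n, (j : ℕ) + 1 = 0 → (j : ℕ) ∈ (∅ : Finset ℕ) := fun j hj =>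
    absurd hj (Nat.succ_ne_zero _)
  have hs : s.domain = jDom M ∅ A K Bd (n + 1) 0 := by rw [h.dom, chain_eq_jDom_top]
  have hsa : ∀ (c : Finset ℕ) (rU rV : ℕ), IsSemialgebraic ℚ (jDom (n := n) M c A K Bd rU rV) :=
    fun _ _ _ => isSemialgebraic_gDom _ _ _ _
  have sub0 : jDom M ∅ A K Bd 0 0 ⊆ s.domain := fun z hz => by
    rw [hs]; exact ((mem_jDom_iff hAK hr hc hcr z).1 hz).1
  have subr : ∀ {r'}, 0 < r' → jDom M (insert (r' - 1) ∅) A K Bd r' r' ⊆ s.domain := fun hr' z hz => by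
    rw [hs]; exact piece_subset_top hKB hr hc hr' hz
  -- the cells
  set R : ℕ → KZ.IntegralRep (0 + 1 + (n + 1)) := fun r' =>
    if hr' : r' = 0 then s.restrict (jDom M ∅ A K Bd 0 0) (hsa _ _ _) sub0
    else s.restrict (jDom M (insert (r' - 1) ∅) A K Bd r' r') (hsa _ _ _) (subr (Nat.pos_of_ne_zero hr'))
    with hR
  have hR0 : R 0 = s.restrict (jDom M ∅ A K Bd 0 0) (hsa _ _ _) sub0 := by simp only [hR, dif_pos rfl]
  have hRne : ∀ {r'} (hr' : r' ≠ 0), R r' = s.restrict (jDom M (insert (r' - 1) ∅) A K Bd r' r')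
      (hsa _ _ _) (subr (Nat.pos_of_ne_zero hr')) := fun h => by simp only [hR, dif_neg h]
  have hsub : ∀ r', (R r').domain ⊆ s.domain := fun r' => by
    by_cases h0 : r' = 0
    · subst h0; rw [hR0]; exact sub0
    · rw [hRne h0]; exact subr (Nat.pos_of_ne_zero h0)
  -- rule (1a)
  have hrel : KZ.of s - ∑ r' ∈ Finset.range (n + 2), KZ.of (R r') ∈ KZ.relations := by
    refine KZ.of_sub_sum_of_mem_relations (Finset.range (n + 2)) s R (fun r' _ => ?_)
      (fun r' _ z _ => ?_) (measure_mono_null (fun z hz => ?_)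
        (measure_iUnion_null fun l : Fin (n + 1) => volume_tv_eq_ev l K)) (fun r' hr' r'' hr'' hne => ?_)
    · rw [sdiff_eq_empty.2 (hsub r'), measure_empty]
    · by_cases h0 : r' = 0
      · subst h0; rw [hR0]; rfl
      · rw [hRne h0]; rfl
    · obtain ⟨hz, hzU⟩ := hz
      rw [mem_iUnion]
      by_contra hne
      push Not at hne
      rw [hs] at hz
      rcases mem_cover hAK hr hc hcr hz (fun l hl => hne l hl) with h' | ⟨r', hrr', hr'n, h'⟩
      · exact hzU (mem_iUnion₂.2 ⟨0, Finset.mem_range.2 (by omega), by rw [hR0]; exact h'⟩)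
      · exact hzU (mem_iUnion₂.2 ⟨r', Finset.mem_range.2 (by omega),
          by rw [hRne (Nat.pos_iff_ne_zero.1 hrr')]; exact h'⟩)
    · have key : ∀ r' ∈ (Finset.range (n + 2) : Set ℕ), ∀ r'' ∈ (Finset.range (n + 2) : Set ℕ),
          r' < r'' → (R r').domain ∩ (R r'').domain = ∅ := by
        intro r' hr' r'' hr'' hlt
        rw [Finset.mem_coe, Finset.mem_range] at hr' hr''
        refine eq_empty_of_forall_notMem fun z ⟨hz', hz''⟩ => ?_
        have h'' : r'' ≠ 0 := by omega
        rw [hRne h''] at hz''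
        by_cases h' : r' = 0
        · subst h'
          rw [hR0] at hz'
          exact not_mem_piece_of_mem hAK hr hc hcr hz' hlt (by omega) hz''
        · rw [hRne h'] at hz'
          exact not_mem_piece_piece hAK hc (Nat.pos_of_ne_zero h') hlt (by omega) hz' hz''
      show volume ((R r').domain ∩ (R r'').domain) = 0
      rcases lt_or_gt_of_ne hne with hlt | hgt
      · rw [key r' hr' r'' hr'' hlt, measure_empty]
      · rw [inter_comm, key r'' hr'' r' hr' hgt, measure_empty]
  -- every cell is good
  refine RebaseZero.good_of_sub_mem hrel (RebaseNest.good_sum _ _ fun r' _ => ?_)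
  by_cases h0 : r' = 0
  · subst h0
    rw [hR0]
    exact good_sepCell rfl (Or.inl h.n1) h.a0 ∅ (fun j _ => Nat.succ_ne_zero _) (h.bdd.subset sub0) rfl
      (h.int.mono sub0)
  · rw [hRne h0]
    refine good_sepCell rfl (Or.inl h.n1) h.a0 _ (fun j hj hj1 => hj ?_)
      (h.bdd.subset (subr (Nat.pos_of_ne_zero h0))) rfl (h.int.mono (subr (Nat.pos_of_ne_zero h0)))
    rw [← hj1, Nat.add_sub_cancel]
    exact Finset.mem_insert_self _ _

/-! ### Thick chains -/

/-- **One grid cell**: a thick clean chain over a base cell shorter than the mesh is separable,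
hence good. -/
theorem IsChain.good_short (hN : IsChain s M A Bd T p a) (m₀ h g : ℚ) (hm : |A.1 (Fin.last 0)| * h ≤ m₀)
    (hc : ∀ y ∈ cell M, (m₀ : ℝ) ≤ ev Bd y - ev A y ∧ (g : ℝ) < y ∧ y < g + h) :
    Good (n + 1) (KZ.of s) := by
  refine hN.good_sep (A.1 (Fin.last 0) * g + A.2 + max (A.1 (Fin.last 0)) 0 * h) fun y hy => ?_
  obtain ⟨hD, h1, h2⟩ := hc y hy
  have hm' : |(A.1 (Fin.last 0) : ℝ)| * h ≤ m₀ := by exact_mod_cast hm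
  have key := sep_ineq (a₂ := (A.2 : ℝ)) h1 h2 hm' hD
  have hev : ev Bd y = ev A y + (ev Bd y - ev A y) := by ring
  rw [hev]
  simp only [ev] at key ⊢
  push_cast
  exact key

/-- **The grid** (induction on the number `N` of cells of mesh `h`): a thick clean chain whose
base cell lies in `(g, g + N h)` is good — cut at `g + h` (rule 1a); the left piece is one grid
cell (`IsChain.good_short`), the right piece has `N − 1` cells. -/
theorem IsChain.good_grid (N : ℕ) : ∀ {m' : ℕ} {M : Fin m' → Cf} {s : KZ.IntegralRep (0 + 1 + (n + 1))}
    (g : ℚ), IsChain s M A Bd T p a → ∀ m₀ h : ℚ, 0 < h → |A.1 (Fin.last 0)| * h ≤ m₀ →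
    (∀ y ∈ cell M, (m₀ : ℝ) ≤ ev Bd y - ev A y ∧ (g : ℝ) < y ∧ y < g + N * h) →
    Good (n + 1) (KZ.of s) := by
  induction N with
  | zero =>
    intro m' M s g hN m₀ h _ _ hc
    exact hN.good_cell_empty fun y hy => by
      obtain ⟨-, h1, h2⟩ := hc y hy
      push_cast at h2
      linarith
  | succ N ih =>
    intro m' M s g hN m₀ h hh hm hc
    refine hN.rowSplit (RebaseZero.mk (-1) (g + h)) (mk_ne_zero (by norm_num) _) (fun s₁ h₁ => ?_)
      (fun s₂ h₂ => ?_)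
    · refine h₁.good_short m₀ h g hm fun y hy => ?_
      rw [mem_cell_snoc] at hy
      obtain ⟨hy, hq⟩ := hy
      obtain ⟨hD, h1, -⟩ := hc y hy
      rw [ev_mk] at hq
      push_cast at hq
      exact ⟨hD, h1, by linarith⟩
    · refine ih (g + h) h₂ m₀ h hh hm fun y hy => ?_
      rw [mem_cell_snoc] at hy
      obtain ⟨hy, hq⟩ := hy
      obtain ⟨hD, -, h2⟩ := hc y hy
      rw [ev_neg, ev_mk] at hq
      push_cast at hq h2 ⊢
      exact ⟨hD, by linarith, by linarith⟩

/-- **Thick clean chains are good**: if `B − A ≥ m₀ > 0` on the base cell, an explicit rational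
grid of mesh `h = m₀/(|A'| + 1)` over `(−R', R') ⊇ cell` dissects the chain into separable pieces. -/
theorem IsChain.good_thick (hN : IsChain s M A Bd T p a) (m₀ : ℚ) (hm₀ : 0 < m₀)
    (hD : ∀ y ∈ cell M, (m₀ : ℝ) ≤ ev Bd y - ev A y) : Good (n + 1) (KZ.of s) := by
  -- the base cell is bounded
  obtain ⟨R, hR⟩ := hN.cell_bound fun y hy => by
    have h0 : (0 : ℝ) < m₀ := by exact_mod_cast hm₀
    linarith [hD y hy]
  obtain ⟨R', hR'⟩ := exists_rat_gt R
  -- the mesh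
  set α : ℚ := A.1 (Fin.last 0) with hα
  set h : ℚ := m₀ / (|α| + 1) with hh
  have hpos : 0 < |α| + 1 := by positivity
  have hh0 : 0 < h := div_pos hm₀ hpos
  have hm : |α| * h ≤ m₀ := by
    rw [hh, mul_div_assoc']
    rw [div_le_iff₀ hpos]
    nlinarith [abs_nonneg α]
  -- the number of cells
  obtain ⟨N, hN'⟩ := exists_nat_gt (2 * R' / h)
  have hNh : 2 * R' < N * h := by rwa [div_lt_iff₀ hh0] at hN'
  refine hN.rowSplit (RebaseZero.mk 1 R') (mk_ne_zero one_ne_zero _) (fun s₁ h₁ => ?_) (fun s₂ h₂ => ?_)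
  · refine h₁.good_grid N (-R') m₀ h hh0 hm fun y hy => ?_
    rw [mem_cell_snoc] at hy
    obtain ⟨hy, hq⟩ := hy
    rw [ev_mk] at hq
    have hyR := (le_abs_self y).trans (hR y hy)
    have hNh' : (2 * R' : ℝ) < N * h := by exact_mod_cast hNh
    push_cast at hq ⊢
    exact ⟨hD y hy, by linarith, by linarith⟩
  · refine h₂.good_cell_empty fun y hy => ?_
    rw [mem_cell_snoc] at hy
    obtain ⟨hy, hq⟩ := hy
    rw [ev_neg, ev_mk] at hq
    have hyR : -R ≤ y := by linarith [neg_abs_le y, hR y hy]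
    push_cast at hq
    linarith

end RebaseChain

/-- Registered support goal of this file (part of `rebaseSimpleZeroMany_common`): thick clean
chains of `n + 1` fibres over a one-dimensional base are good (`RebaseChain.IsChain.good_thick`). -/
theorem rebaseSimpleZeroMany_chainThick (n m' : ℕ) (s : KZ.IntegralRep (0 + 1 + (n + 1))) (M : Fin m' → (Fin (0 + 1) → ℚ) × ℚ) (A Bd : (Fin (0 + 1) → ℚ) × ℚ) (T : RebaseZero.BData) (p : MvPolynomial (Fin 0) ℚ) (a : Fin (n + 1) → Option ((Fin (0 + 1) → ℚ) × ℚ)) (hN : RebaseChain.IsChain s M A Bd T p a) (m₀ : ℚ) (hm₀ : 0 < m₀) (hD : ∀ y ∈ RebaseZero.cell M, (m₀ : ℝ) ≤ RebaseZero.ev Bd y - RebaseZero.ev A y) : RebaseZero.Good (n + 1) (KZ.of s) :=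
  hN.good_thick m₀ hm₀ hD

end Summit.KontsevichZagierPeriods.ArrangementNormalForm.JanusBands
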